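import Summits.QuantumFields.YangMills.Theorems.LuscherReductionTwistedTraceScalingToronMinimality
import HarnessLib

/-!
# The zero-momentum (ONE-SITE) term of the toron zero-point sum and the even, gapped remainder
# (VALLEY term of S-BASE, crux `TwistedTraceScaling` stmt-QuantumFields-20203; architecture note `pub/ym-fleet/ym-luscher-20007-p1/COARSE-DESIGN.md` §14)

`toronZPE L κ 0 α = Σ_{j ∈ (ℤ/L)³} modeZPE(κ·lap3 L α j)` splits as the `j = 0` term `modeZPE(κ·Σ_k(2 − 2cos α_k))` — the zero-point energy of the constant
(zero-momentum) charged modes, i.e. of the ONE-SITE model sitting inside the lattice on constant links — plus the remainder over `j ≠ 0`.  The remainder is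
EVEN in `α` (reindex `j ↦ −j`) and GAPPED at `α = 0` (`lap3 L 0 j ≥ 2 − 2cos(2π/L) > 0` for `j ≠ 0`, `L ≥ 2`), hence a smooth second-order correction, while the
LINEAR toron gain near the vacuum lives entirely in the `j = 0` term.  This is the bookkeeping behind the Born–Oppenheimer reading of the valley (§14):
exact one-site factor × gapped stiff perturbation.
* `zeroModeZPE`, `restZPE`, ★ `toronZPE_eq_zeroModeZPE_add_restZPE`; `lap1_neg`, `lap3_neg`, `toronZPE_neg`, ★ `restZPE_neg` (evenness);
* ★ `two_sub_two_cos_le_lap1` (`i ≠ 0 ⇒ lap1 L 0 i ≥ 2 − 2cos(2π/L)`), ★ `gap_le_lap3` (`j ≠ 0 ⇒ lap3 L 0 j ≥ 2 − 2cos(2π/L)`), `gap_pos` (`L ≥ 2`).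

HONEST FRAMING: trigonometric bookkeeping at fixed `L`; femto rung R2b1 (brick for a stub of a child of a CONDITIONAL route); not a gap, not Clay.
-/

set_option autoImplicit false

noncomputable section

open Finset
open scoped BigOperators

namespace Summit.QuantumFields.YangMills.Theorems.FemtoTransferGap.TwoLattice.Toron

open Summit.QuantumFields.YangMills.Theorems.FemtoTransferGap

variable (L : ℕ) [NeZero L]

/-! ## §1 The split -/

/-- The zero-momentum (one-site) zero-point term `modeZPE(κ·Σ_k (2 − 2cos α_k))`. [cite: Luscher1983, §3] -/
def zeroModeZPE (κ : ℝ) (α : Fin 3 → ℝ) : ℝ := modeZPE (κ * ∑ k, (2 - 2 * Real.cos (α k)))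

/-- The remainder of the toron zero-point sum over nonzero momenta. [cite: Luscher1983, §3] -/
def restZPE (κ : ℝ) (α : Fin 3 → ℝ) : ℝ := ∑ j ∈ (univ : Finset (Fin 3 → Fin L)).erase 0, modeZPE (κ * lap3 L α j)

/-- At zero momentum `lap3` is the one-site symbol `Σ_k (2 − 2cos α_k)`. [folklore] -/
theorem lap3_zero_momentum (α : Fin 3 → ℝ) : lap3 L α 0 = ∑ k, (2 - 2 * Real.cos (α k)) := by
  unfold lap3 lap1
  exact sum_congr rfl fun k _ => by simp

/-- ★ **Split** `toronZPE L κ 0 α = zeroModeZPE κ α + restZPE L κ α`. [cite: Luscher1983, §3] -/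
theorem toronZPE_eq_zeroModeZPE_add_restZPE (κ : ℝ) (α : Fin 3 → ℝ) : toronZPE L κ 0 α = zeroModeZPE κ α + restZPE L κ α := by
  unfold toronZPE restZPE zeroModeZPE
  rw [← add_sum_erase _ _ (mem_univ (0 : Fin 3 → Fin L)), zero_add, lap3_zero_momentum]
  simp only [zero_add]

/-! ## §2 Evenness -/

/-- `lap1 L (−a) i = lap1 L a (−i)` (momentum reversal). [folklore] -/
theorem lap1_neg (a : ℝ) (i : Fin L) : lap1 L (-a) i = lap1 L a (-i) := by
  unfold lap1
  congr 1
  have hL : (0 : ℝ) < L := by exact_mod_cast NeZero.pos L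
  -- `(i : ℕ) + ((-i : Fin L) : ℕ)` is `0` or `L`
  have hsum : ((i : ℕ) + ((-i : Fin L) : ℕ)) % L = 0 := by
    have h := Fin.val_add i (-i)
    rw [add_neg_cancel, Fin.val_zero] at h
    exact h.symm
  obtain ⟨m, hm⟩ := Nat.dvd_of_mod_eq_zero hsum
  have hcast : (((-i : Fin L) : ℕ) : ℝ) = m * L - (i : ℕ) := by
    have : (((i : ℕ) + ((-i : Fin L) : ℕ) : ℕ) : ℝ) = ((L * m : ℕ) : ℝ) := by exact_mod_cast hm
    push_cast at this; linarith
  rw [hcast]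
  have : a + 2 * Real.pi * ((m : ℝ) * L - (i : ℕ)) / L = -(-a + 2 * Real.pi * (i : ℕ) / L) + (m : ℕ) * (2 * Real.pi) := by
    field_simp; ring
  rw [this, Real.cos_add_nat_mul_two_pi, Real.cos_neg]

/-- `lap3 L (−α) j = lap3 L α (−j)`. [folklore] -/
theorem lap3_neg (α : Fin 3 → ℝ) (j : Fin 3 → Fin L) : lap3 L (-α) j = lap3 L α (-j) := by
  unfold lap3
  exact sum_congr rfl fun k _ => by rw [Pi.neg_apply, Pi.neg_apply, lap1_neg]

/-- `toronZPE` is even in the twists. [folklore] -/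
theorem toronZPE_neg (κ m : ℝ) (α : Fin 3 → ℝ) : toronZPE L κ m (-α) = toronZPE L κ m α := by
  unfold toronZPE
  simp_rw [lap3_neg]
  exact Equiv.sum_comp (Equiv.neg (Fin 3 → Fin L)) (fun j => modeZPE (m + κ * lap3 L α j))

/-- The zero-momentum term is even. [folklore] -/
theorem zeroModeZPE_neg (κ : ℝ) (α : Fin 3 → ℝ) : zeroModeZPE κ (-α) = zeroModeZPE κ α := by
  unfold zeroModeZPE
  simp only [Pi.neg_apply, Real.cos_neg]

/-- ★ **The remainder is even**: `restZPE L κ (−α) = restZPE L κ α`. [folklore] -/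
theorem restZPE_neg (κ : ℝ) (α : Fin 3 → ℝ) : restZPE L κ (-α) = restZPE L κ α := by
  have h1 := toronZPE_eq_zeroModeZPE_add_restZPE L κ (-α)
  have h2 := toronZPE_eq_zeroModeZPE_add_restZPE L κ α
  rw [toronZPE_neg, zeroModeZPE_neg] at h1
  linarith

/-! ## §3 The gap of the remainder at the vacuum -/

/-- ★ For a nonzero momentum index `i : Fin L`: `2 − 2cos(2π/L) ≤ lap1 L 0 i` (the 1D lattice Laplacian's gap). [folklore] -/
theorem two_sub_two_cos_le_lap1 {i : Fin L} (hi : i ≠ 0) : 2 - 2 * Real.cos (2 * Real.pi / L) ≤ lap1 L 0 i := by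
  unfold lap1
  rw [zero_add]
  have hL : (0 : ℝ) < L := by exact_mod_cast NeZero.pos L
  have hi1 : (1 : ℝ) ≤ (i : ℕ) := by
    have : 1 ≤ (i : ℕ) := Nat.one_le_iff_ne_zero.mpr (fun h => hi (Fin.ext h))
    exact_mod_cast this
  have hiL : ((i : ℕ) : ℝ) ≤ L - 1 := by
    have : (i : ℕ) + 1 ≤ L := i.isLt
    have : (((i : ℕ) + 1 : ℕ) : ℝ) ≤ L := by exact_mod_cast this
    push_cast at this; linarith
  -- reduce to the half nearer to `0`: `cos(2πi/L) = cos(2π(L−i)/L)`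
  suffices h : Real.cos (2 * Real.pi * (i : ℕ) / L) ≤ Real.cos (2 * Real.pi / L) by linarith
  by_cases hhalf : 2 * ((i : ℕ) : ℝ) ≤ L
  · -- `2π/L ≤ 2πi/L ≤ π`
    refine Real.cos_le_cos_of_nonneg_of_le_pi (by positivity) ?_ ?_
    · rw [div_le_iff₀ hL]; nlinarith [Real.pi_pos]
    · rw [div_le_div_iff_of_pos_right hL]; nlinarith [Real.pi_pos]
  · push Not at hhalf
    have hsym : Real.cos (2 * Real.pi * (i : ℕ) / L) = Real.cos (2 * Real.pi * ((L : ℝ) - (i : ℕ)) / L) := by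
      rw [show 2 * Real.pi * ((L : ℝ) - (i : ℕ)) / L = -(2 * Real.pi * (i : ℕ) / L) + (1 : ℕ) * (2 * Real.pi) by field_simp; ring,
        Real.cos_add_nat_mul_two_pi, Real.cos_neg]
    rw [hsym]
    refine Real.cos_le_cos_of_nonneg_of_le_pi (by positivity) ?_ ?_
    · rw [div_le_iff₀ hL]; nlinarith [Real.pi_pos]
    · rw [div_le_div_iff_of_pos_right hL]; nlinarith [Real.pi_pos]

/-- ★ **Gap of the remainder**: for `j ≠ 0`, `2 − 2cos(2π/L) ≤ lap3 L 0 j`. [folklore] -/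
theorem gap_le_lap3 {j : Fin 3 → Fin L} (hj : j ≠ 0) : 2 - 2 * Real.cos (2 * Real.pi / L) ≤ lap3 L 0 j := by
  obtain ⟨k, hk⟩ := Function.ne_iff.mp hj
  unfold lap3
  calc 2 - 2 * Real.cos (2 * Real.pi / L) ≤ lap1 L ((0 : Fin 3 → ℝ) k) (j k) := by
        rw [Pi.zero_apply]; exact two_sub_two_cos_le_lap1 L hk
    _ ≤ ∑ k', lap1 L ((0 : Fin 3 → ℝ) k') (j k') := single_le_sum (fun k' _ => lap1_nonneg L _ _) (mem_univ k)

omit [NeZero L] in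
/-- The gap is positive for `L ≥ 2`. [folklore] -/
theorem gap_pos (hL : 2 ≤ L) : 0 < 2 - 2 * Real.cos (2 * Real.pi / L) := by
  have hL' : (2 : ℝ) ≤ L := by exact_mod_cast hL
  have h1 : 0 < 2 * Real.pi / L := by positivity
  have h2 : 2 * Real.pi / L ≤ Real.pi := by rw [div_le_iff₀ (by linarith)]; nlinarith [Real.pi_pos]
  have h3 : Real.cos (2 * Real.pi / L) < Real.cos 0 :=
    Real.cos_lt_cos_of_nonneg_of_le_pi le_rfl h2 h1
  rw [Real.cos_zero] at h3
  linarith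

/-- Hence every remainder mode has zero-point energy bounded below at the vacuum: `modeZPE(κ·gap) ≤ modeZPE(κ·lap3 L 0 j)` (`κ ≥ 0`, `j ≠ 0`). [folklore] -/
theorem modeZPE_gap_le {κ : ℝ} (hκ : 0 ≤ κ) {j : Fin 3 → Fin L} (hj : j ≠ 0) :
    modeZPE (κ * (2 - 2 * Real.cos (2 * Real.pi / L))) ≤ modeZPE (κ * lap3 L 0 j) :=
  modeZPE_le_modeZPE (mul_nonneg hκ (by nlinarith [Real.cos_le_one (2 * Real.pi / L)]))
    (mul_le_mul_of_nonneg_left (gap_le_lap3 L hj) hκ)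

end Summit.QuantumFields.YangMills.Theorems.FemtoTransferGap.TwoLattice.Toron

end
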